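import Summits.Ventures.CertifiedManyBodySolver.Certificates.HubbardSquare_n7o8_pinning_menus_tPrimeBox_pairAmpCeilings
import HarnessLib
import HarnessLib.Audit

/-!
# Ventures/CertifiedManyBodySolver — Certificates/HubbardSquare_n7o8_pinning_menuA0_tPrimeBox_pairAmpCeilings_diagHopWindow.lean

HONEST FRAMING: first certified bounds; not a superconductivity verdict; every number certified or labelled float. A CEILING on a
`d`-wave pair amplitude never speaks to the presence or absence of order; no phase sentence; CANDIDATE until the named nodes are
referee-replayed. WHAT-THIS-IS-NOT: a floor; a number of record beyond its named premises.

The `K₂`-WORD edition of `HubbardSquare_n7o8_pinning_menus_tPrimeBox_pairAmpCeilings.lean` (hubbard-box-p3 g4, p486616: the kinematic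
registry-only `t'`-box ceilings, excess `2·1.6212/20 = 0.16212`). Here the TARGET canonical cap is the anchor cap #445 moved along the
anchor ground states' certified `K₂` window — box-eng-2's hypothesis `hτ3` of the cuprate box words (`HubbardSquare_n7o8_boxword_cuprate_v3.lean`;
eng's A8m25 bd4+rdm-tet class window `K₂ ∈ [−0.6023622597, 1.0872271385]` on every torus-limit ground state at (8, 7/8, −1/4)) — by the
tangent caps `energyDensityTT'_sub_le_mul_of_forall_diagHop_le` / `mul_le_energyDensityTT'_sub_of_forall_le_diagHop`
(`HubbardTTPrimeDiagHopTransport`), so the box excess is `(1.0872271385 + 1.6212)/20 = 0.13542…` and the A0 slots improve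
(L2 g = 0, the ORDER-PARAMETER class at h = 0: `0.8964936 → 0.8740155` on `t' ∈ [−0.30, −0.20]`). §1 generic lemma, §2 the nine A0 nodes.
Premises BY NAME per theorem: the priced node (hubbard-obs-pin-1 p485396; CANDIDATE), #445 (`cert_dbt329pair_allk`), `hτ3`.

References: T. Koma, H. Tasaki, J. Stat. Phys. 76 (1994) 745 §1; J. Wang et al., Phys. Rev. X 14 (2024) 031006 §III; R. B. Griffiths,
Phys. Rev. 152 (1966) 240 §II (tangent caps of a concave energy).
-/

noncomputable section

namespace Summit.Ventures.CertifiedManyBodySolver.Certificates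

open Literature.MathematicalPhysics.QuantumLattice Literature.MathematicalPhysics.QuantumLattice.ThermodynamicLimit
open Literature.Probability.LatticeModels HubbardWave0 InfVolFermionState
open Summit.Ventures.CertifiedManyBodySolver
open scoped ComplexOrder

/-! ### §1–§2 K₂-WORD edition at A0: the target caps from the anchor's ground-state `K₂` window (box-eng-2's `hτ3` hypothesis, eng's
A8m25 rdm-tet window `K₂ ∈ [−0.6023622597, 1.0872271385]`), excess `(1.0872271385 + 1.6212)/20 = 0.1354…` instead of `0.16212` -/

/-- **`t'`-BOX PAIR-AMPLITUDE CEILING FROM ONE PRICED MENU NODE, `K₂`-WORD edition**: as §1, but the target canonical cap is the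
anchor cap moved along the anchor ground states' certified `K₂` window `[B, A]` (tangent caps `energyDensityTT'_sub_le_mul_of_forall_diagHop_le` /
`mul_le_energyDensityTT'_sub_of_forall_le_diagHop`): `R(t') = u₀ + max(A, −B)·|t'₀ − t'|`, so the slot inequality reads
`M̃ + κ·((max(A,−B) + 1.6212)·r) ≤ M·1.41421356` (`max(A,−B) ≥ 0` assumed). Ceiling only. -/
theorem pairAmp_le_slot_on_tPrimeBox_of_pricedNode_of_diagHopWindow {t'₀ U n h u₀ Mt κ r M A B : ℝ} (hU : 0 ≤ U)
    (hn0 : 0 ≤ n) (hn2 : n < 2) (hκ : 0 ≤ κ) (hM : 0 ≤ M) (hw : 0 ≤ max A (-B))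
    (hP : ∀ σ : InfVolFermionState 2, σ.IsTranslationInvariant → σ.density = n →
      Real.sqrt 2 * (σ.expect (pairRegion (insert 0 unitSteps) 0) (localPairAt (insert 0 unitSteps) dWaveFormFactor 0)).re ≤
        Mt + κ * (σ.meanEnergy (hubbardTTPrimeSourcedInteraction 1 t'₀ U 0 dWaveFormFactor h) 1 - u₀))
    (hcap : energyDensityTT' 1 t'₀ U n ≤ u₀)
    (hAB : ∀ (ω : InfVolFermionState 2) (Ls : ℕ → ℕ) (ψ : ∀ L, Fock (Orb (FermionTorus 2 L))),
      Filter.Tendsto Ls Filter.atTop Filter.atTop →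
      (∀ j, IsGroundStateInSector (hubbardTorusTT' (Ls j) 1 t'₀ U) (rectN n (Ls j)) 0 (ψ (Ls j))) →
      (∀ j, star (ψ (Ls j)) ⬝ᵥ ψ (Ls j) = 1) → ω.IsTorusLimitOf ψ Ls →
      B ≤ ω.meanEnergy (hubbardTTPrimeFermionInteraction 0 1 0) 1 ∧
        ω.meanEnergy (hubbardTTPrimeFermionInteraction 0 1 0) 1 ≤ A)
    (hslot : Mt + κ * ((max A (-B) + 1.6212) * r) ≤ M * (141421356 / 100000000 : ℝ))
    {t' : ℝ} (ht : |t'₀ - t'| ≤ r)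
    {ω : InfVolFermionState 2} (hω : ω.IsTranslationInvariant) (hρ : ω.density = n)
    (hmin : ∀ ω' : InfVolFermionState 2, ω'.IsTranslationInvariant → ω'.density = n →
      ω.meanEnergy (hubbardTTPrimeSourcedInteraction 1 t' U 0 dWaveFormFactor h) 1 ≤
        ω'.meanEnergy (hubbardTTPrimeSourcedInteraction 1 t' U 0 dWaveFormFactor h) 1) :
    (ω.expect (pairRegion (insert 0 unitSteps) 0) (localPairAt (insert 0 unitSteps) dWaveFormFactor 0)).re ≤ M := by
  -- the target canonical cap `R(t') = u₀ + max(A,−B)·|t'₀ − t'|`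
  have hmA := le_max_left A (-B)
  have hmB := le_max_right A (-B)
  have hR : energyDensityTT' 1 t' U n ≤ u₀ + max A (-B) * |t'₀ - t'| := by
    rcases le_total t'₀ t' with hge | hle
    · have h1 := energyDensityTT'_sub_le_mul_of_forall_diagHop_le 1 (s₁ := t'₀) (s := t'₀) (s' := t') le_rfl hge hU hn0 hn2
        (A := A) (fun ω₁ Ls₁ ψ₁ hL hgs h1' hω₁ => (hAB ω₁ Ls₁ ψ₁ hL hgs h1' hω₁).2)
      rw [abs_of_nonpos (sub_nonpos.2 hge), neg_sub]
      nlinarith [mul_le_mul_of_nonneg_right hmA (sub_nonneg.2 hge)]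
    · have h1 := mul_le_energyDensityTT'_sub_of_forall_le_diagHop 1 (s := t') (s' := t'₀) (s₂ := t'₀) hle le_rfl hU hn0 hn2
        (B := B) (fun ω₂ Ls₂ ψ₂ hL hgs h1' hω₂ => (hAB ω₂ Ls₂ ψ₂ hL hgs h1' hω₂).1)
      rw [abs_of_nonneg (sub_nonneg.2 hle)]
      nlinarith [mul_le_mul_of_nonneg_right hmB (sub_nonneg.2 hle)]
  have key := canonicalMinimiser_le_priced_of_capClass_tPrime
    (f := fun σ => Real.sqrt 2 * (σ.expect (pairRegion (insert 0 unitSteps) 0)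
      (localPairAt (insert 0 unitSteps) dWaveFormFactor 0)).re) hU hn0 hn2 hκ hP hR hω hρ hmin
  have hpi := sixteen_div_pi_sq_lt_decimal
  have h0 : 0 ≤ |t'₀ - t'| := abs_nonneg _
  have hκ2 : κ * (u₀ + max A (-B) * |t'₀ - t'| + 16 / Real.pi ^ 2 * |t'₀ - t'| - u₀) ≤
      κ * ((max A (-B) + 1.6212) * r) := by
    apply mul_le_mul_of_nonneg_left _ hκ
    have hw2 : 0 ≤ max A (-B) + 1.6212 := by linarith
    nlinarith [mul_le_mul_of_nonneg_left ht hw2, mul_le_mul_of_nonneg_right hpi.le h0]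
  exact le_slot_of_sqrt_two_mul_le (by simpa using key.trans (by linarith)) hM hslot

/-- **ORDER-PARAMETER CLASS `t'`-BOX CEILING, `K₂`-word edition, node `cert_pin2_A0menu_L2_U8_n7o8_tpm1o4_g0_pairAmpMax_priced_j256528`** (A0; anchor slot 0.7600015, kinematic box slot 1120617/1250000): for every `t' ∈ [−0.30, −0.20]` (U = 8), every translation-invariant density-7/8 GROUND STATE of the unsourced `t–t'` Hubbard model has **`Re ω(P₀^d) ≤ 0.8740155`** (slot `1748031/2000000` = ⌈(M̃ + κ·0.1354213…)/1.41421356⌉₇). Premises BY NAME: the priced node (CANDIDATE), #445, and the A8m25 ground-state `K₂` window `hτ3` (eng rdm-tet class, the hypothesis of box-eng-2's cuprate box words). Ceiling only; no phase sentence. -/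
theorem pin2_A0menu_L2_U8_n7o8_tpm1o4_g0_j256528_pairAmp_le_on_tPrimeBox_of_pricedNode_diagHopWindow
    (hP : cert_pin2_A0menu_L2_U8_n7o8_tpm1o4_g0_pairAmpMax_priced_j256528) (h445 : cert_dbt329pair_allk)
    (hτ3 : ∀ (ω : InfVolFermionState 2) (Ls : ℕ → ℕ) (ψ : ∀ L, Fock (Orb (FermionTorus 2 L))),
      Filter.Tendsto Ls Filter.atTop Filter.atTop →
      (∀ j, IsGroundStateInSector (hubbardTorusTT' (Ls j) 1 (-1/4) 8) (rectN (7/8) (Ls j)) 0 (ψ (Ls j))) →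
      (∀ j, star (ψ (Ls j)) ⬝ᵥ ψ (Ls j) = 1) → ω.IsTorusLimitOf ψ Ls →
      ((-6023622597/10000000000 : ℚ) : ℝ) ≤ ω.meanEnergy (hubbardTTPrimeFermionInteraction 0 1 0) 1 ∧
        ω.meanEnergy (hubbardTTPrimeFermionInteraction 0 1 0) 1 ≤ ((2174454277/2000000000 : ℚ) : ℝ))
    {t' : ℝ} (ht : t' ∈ Set.Icc (-3/10 : ℝ) (-1/5))
    {ω : InfVolFermionState 2} (hω : ω.IsTranslationInvariant) (hρ : ω.density = 7 / 8)
    (hmin : ∀ ω' : InfVolFermionState 2, ω'.IsTranslationInvariant → ω'.density = 7 / 8 →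
      ω.meanEnergy (hubbardTTPrimeSourcedInteraction 1 t' 8 0 dWaveFormFactor 0) 1 ≤
        ω'.meanEnergy (hubbardTTPrimeSourcedInteraction 1 t' 8 0 dWaveFormFactor 0) 1) :
    (ω.expect (pairRegion (insert 0 unitSteps) 0) (localPairAt (insert 0 unitSteps) dWaveFormFactor 0)).re ≤
      (((1748031/2000000 : ℚ)) : ℝ) := by
  have hr : |((-1/4) : ℝ) - t'| ≤ 1 / 20 := by
    rw [abs_le]; constructor <;> linarith [ht.1, ht.2]
  have hw : (0 : ℝ) ≤ max (((2174454277/2000000000 : ℚ) : ℝ)) (-(((-6023622597/10000000000 : ℚ) : ℝ))) :=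
    le_max_of_le_left (by norm_num)
  exact pairAmp_le_slot_on_tPrimeBox_of_pricedNode_of_diagHopWindow (t'₀ := -1/4) (by norm_num) (by norm_num) (by norm_num)
    (by norm_num) (by norm_num) hw hP (energyDensityTT'_le_hi445_of_node h445) hτ3
    (by rw [max_eq_left (by norm_num)]; norm_num) hr hω hρ hmin

/-- **`t'`-BOX CEILING, `K₂`-word edition, node `cert_pin2_A0menu_L2_U8_n7o8_tpm1o4_g1o112_pairAmpMax_priced_j256528`** (A0; anchor slot 0.7762063, kinematic box slot 9105827/10000000): for every `t' ∈ [−0.30, −0.20]` (U = 8), every translation-invariant density-7/8 minimiser of the `d`-wave-sourced energy at field `h = (√2 * (1/112 : ℝ))` has **`Re ω(P₀^d) ≤ 0.8884530`** (slot `888453/1000000` = ⌈(M̃ + κ·0.1354213…)/1.41421356⌉₇). Premises BY NAME: the priced node (CANDIDATE), #445, and the A8m25 ground-state `K₂` window `hτ3` (eng rdm-tet class, the hypothesis of box-eng-2's cuprate box words). Ceiling only; no phase sentence. -/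
theorem pin2_A0menu_L2_U8_n7o8_tpm1o4_g1o112_j256528_pairAmp_le_on_tPrimeBox_of_pricedNode_diagHopWindow
    (hP : cert_pin2_A0menu_L2_U8_n7o8_tpm1o4_g1o112_pairAmpMax_priced_j256528) (h445 : cert_dbt329pair_allk)
    (hτ3 : ∀ (ω : InfVolFermionState 2) (Ls : ℕ → ℕ) (ψ : ∀ L, Fock (Orb (FermionTorus 2 L))),
      Filter.Tendsto Ls Filter.atTop Filter.atTop →
      (∀ j, IsGroundStateInSector (hubbardTorusTT' (Ls j) 1 (-1/4) 8) (rectN (7/8) (Ls j)) 0 (ψ (Ls j))) →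
      (∀ j, star (ψ (Ls j)) ⬝ᵥ ψ (Ls j) = 1) → ω.IsTorusLimitOf ψ Ls →
      ((-6023622597/10000000000 : ℚ) : ℝ) ≤ ω.meanEnergy (hubbardTTPrimeFermionInteraction 0 1 0) 1 ∧
        ω.meanEnergy (hubbardTTPrimeFermionInteraction 0 1 0) 1 ≤ ((2174454277/2000000000 : ℚ) : ℝ))
    {t' : ℝ} (ht : t' ∈ Set.Icc (-3/10 : ℝ) (-1/5))
    {ω : InfVolFermionState 2} (hω : ω.IsTranslationInvariant) (hρ : ω.density = 7 / 8)
    (hmin : ∀ ω' : InfVolFermionState 2, ω'.IsTranslationInvariant → ω'.density = 7 / 8 →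
      ω.meanEnergy (hubbardTTPrimeSourcedInteraction 1 t' 8 0 dWaveFormFactor (Real.sqrt 2 * (1/112 : ℝ))) 1 ≤
        ω'.meanEnergy (hubbardTTPrimeSourcedInteraction 1 t' 8 0 dWaveFormFactor (Real.sqrt 2 * (1/112 : ℝ))) 1) :
    (ω.expect (pairRegion (insert 0 unitSteps) 0) (localPairAt (insert 0 unitSteps) dWaveFormFactor 0)).re ≤
      (((888453/1000000 : ℚ)) : ℝ) := by
  have hr : |((-1/4) : ℝ) - t'| ≤ 1 / 20 := by
    rw [abs_le]; constructor <;> linarith [ht.1, ht.2]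
  have hw : (0 : ℝ) ≤ max (((2174454277/2000000000 : ℚ) : ℝ)) (-(((-6023622597/10000000000 : ℚ) : ℝ))) :=
    le_max_of_le_left (by norm_num)
  exact pairAmp_le_slot_on_tPrimeBox_of_pricedNode_of_diagHopWindow (t'₀ := -1/4) (by norm_num) (by norm_num) (by norm_num)
    (by norm_num) (by norm_num) hw hP (energyDensityTT'_le_hi445_of_node h445) hτ3
    (by rw [max_eq_left (by norm_num)]; norm_num) hr hω hρ hmin

/-- **`t'`-BOX CEILING, `K₂`-word edition, node `cert_pin2_A0menu_L2_U8_n7o8_tpm1o4_g1o56_pairAmpMax_priced_j256528`** (A0; anchor slot 0.7924903, kinematic box slot 9246671/10000000): for every `t' ∈ [−0.30, −0.20]` (U = 8), every translation-invariant density-7/8 minimiser of the `d`-wave-sourced energy at field `h = (√2 * (1/56 : ℝ))` has **`Re ω(P₀^d) ≤ 0.9028996`** (slot `2257249/2500000` = ⌈(M̃ + κ·0.1354213…)/1.41421356⌉₇). Premises BY NAME: the priced node (CANDIDATE), #445, and the A8m25 ground-state `K₂` window `hτ3` (eng rdm-tet class, the hypothesis of box-eng-2's cuprate box words). Ceiling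 only; no phase sentence. -/
theorem pin2_A0menu_L2_U8_n7o8_tpm1o4_g1o56_j256528_pairAmp_le_on_tPrimeBox_of_pricedNode_diagHopWindow
    (hP : cert_pin2_A0menu_L2_U8_n7o8_tpm1o4_g1o56_pairAmpMax_priced_j256528) (h445 : cert_dbt329pair_allk)
    (hτ3 : ∀ (ω : InfVolFermionState 2) (Ls : ℕ → ℕ) (ψ : ∀ L, Fock (Orb (FermionTorus 2 L))),
      Filter.Tendsto Ls Filter.atTop Filter.atTop →
      (∀ j, IsGroundStateInSector (hubbardTorusTT' (Ls j) 1 (-1/4) 8) (rectN (7/8) (Ls j)) 0 (ψ (Ls j))) →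
      (∀ j, star (ψ (Ls j)) ⬝ᵥ ψ (Ls j) = 1) → ω.IsTorusLimitOf ψ Ls →
      ((-6023622597/10000000000 : ℚ) : ℝ) ≤ ω.meanEnergy (hubbardTTPrimeFermionInteraction 0 1 0) 1 ∧
        ω.meanEnergy (hubbardTTPrimeFermionInteraction 0 1 0) 1 ≤ ((2174454277/2000000000 : ℚ) : ℝ))
    {t' : ℝ} (ht : t' ∈ Set.Icc (-3/10 : ℝ) (-1/5))
    {ω : InfVolFermionState 2} (hω : ω.IsTranslationInvariant) (hρ : ω.density = 7 / 8)
    (hmin : ∀ ω' : InfVolFermionState 2, ω'.IsTranslationInvariant → ω'.density = 7 / 8 →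
      ω.meanEnergy (hubbardTTPrimeSourcedInteraction 1 t' 8 0 dWaveFormFactor (Real.sqrt 2 * (1/56 : ℝ))) 1 ≤
        ω'.meanEnergy (hubbardTTPrimeSourcedInteraction 1 t' 8 0 dWaveFormFactor (Real.sqrt 2 * (1/56 : ℝ))) 1) :
    (ω.expect (pairRegion (insert 0 unitSteps) 0) (localPairAt (insert 0 unitSteps) dWaveFormFactor 0)).re ≤
      (((2257249/2500000 : ℚ)) : ℝ) := by
  have hr : |((-1/4) : ℝ) - t'| ≤ 1 / 20 := by
    rw [abs_le]; constructor <;> linarith [ht.1, ht.2]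
  have hw : (0 : ℝ) ≤ max (((2174454277/2000000000 : ℚ) : ℝ)) (-(((-6023622597/10000000000 : ℚ) : ℝ))) :=
    le_max_of_le_left (by norm_num)
  exact pairAmp_le_slot_on_tPrimeBox_of_pricedNode_of_diagHopWindow (t'₀ := -1/4) (by norm_num) (by norm_num) (by norm_num)
    (by norm_num) (by norm_num) hw hP (energyDensityTT'_le_hi445_of_node h445) hτ3
    (by rw [max_eq_left (by norm_num)]; norm_num) hr hω hρ hmin

/-- **`t'`-BOX CEILING, `K₂`-word edition, node `cert_pin2_A0menu_L2_U8_n7o8_tpm1o4_g1o28_pairAmpMax_priced_j256528`** (A0; anchor slot 0.8252139, kinematic box slot 9527379/10000000): for every `t' ∈ [−0.30, −0.20]` (U = 8), every translation-invariant density-7/8 minimiser of the `d`-wave-sourced energy at field `h = (√2 * (1/28 : ℝ))` has **`Re ω(P₀^d) ≤ 0.9317367`** (slot `9317367/10000000` = ⌈(M̃ + κ·0.1354213…)/1.41421356⌉₇). Premises BY NAME: the priced node (CANDIDATE), #445, and the A8m25 ground-state `K₂` window `hτ3` (eng rdm-tet class, the hypothesis of box-eng-2's cuprate box words). Ceiling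 only; no phase sentence. -/
theorem pin2_A0menu_L2_U8_n7o8_tpm1o4_g1o28_j256528_pairAmp_le_on_tPrimeBox_of_pricedNode_diagHopWindow
    (hP : cert_pin2_A0menu_L2_U8_n7o8_tpm1o4_g1o28_pairAmpMax_priced_j256528) (h445 : cert_dbt329pair_allk)
    (hτ3 : ∀ (ω : InfVolFermionState 2) (Ls : ℕ → ℕ) (ψ : ∀ L, Fock (Orb (FermionTorus 2 L))),
      Filter.Tendsto Ls Filter.atTop Filter.atTop →
      (∀ j, IsGroundStateInSector (hubbardTorusTT' (Ls j) 1 (-1/4) 8) (rectN (7/8) (Ls j)) 0 (ψ (Ls j))) →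
      (∀ j, star (ψ (Ls j)) ⬝ᵥ ψ (Ls j) = 1) → ω.IsTorusLimitOf ψ Ls →
      ((-6023622597/10000000000 : ℚ) : ℝ) ≤ ω.meanEnergy (hubbardTTPrimeFermionInteraction 0 1 0) 1 ∧
        ω.meanEnergy (hubbardTTPrimeFermionInteraction 0 1 0) 1 ≤ ((2174454277/2000000000 : ℚ) : ℝ))
    {t' : ℝ} (ht : t' ∈ Set.Icc (-3/10 : ℝ) (-1/5))
    {ω : InfVolFermionState 2} (hω : ω.IsTranslationInvariant) (hρ : ω.density = 7 / 8)
    (hmin : ∀ ω' : InfVolFermionState 2, ω'.IsTranslationInvariant → ω'.density = 7 / 8 →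
      ω.meanEnergy (hubbardTTPrimeSourcedInteraction 1 t' 8 0 dWaveFormFactor (Real.sqrt 2 * (1/28 : ℝ))) 1 ≤
        ω'.meanEnergy (hubbardTTPrimeSourcedInteraction 1 t' 8 0 dWaveFormFactor (Real.sqrt 2 * (1/28 : ℝ))) 1) :
    (ω.expect (pairRegion (insert 0 unitSteps) 0) (localPairAt (insert 0 unitSteps) dWaveFormFactor 0)).re ≤
      (((9317367/10000000 : ℚ)) : ℝ) := by
  have hr : |((-1/4) : ℝ) - t'| ≤ 1 / 20 := by
    rw [abs_le]; constructor <;> linarith [ht.1, ht.2]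
  have hw : (0 : ℝ) ≤ max (((2174454277/2000000000 : ℚ) : ℝ)) (-(((-6023622597/10000000000 : ℚ) : ℝ))) :=
    le_max_of_le_left (by norm_num)
  exact pairAmp_le_slot_on_tPrimeBox_of_pricedNode_of_diagHopWindow (t'₀ := -1/4) (by norm_num) (by norm_num) (by norm_num)
    (by norm_num) (by norm_num) hw hP (energyDensityTT'_le_hi445_of_node h445) hτ3
    (by rw [max_eq_left (by norm_num)]; norm_num) hr hω hρ hmin

/-- **`t'`-BOX CEILING, `K₂`-word edition, node `cert_pin2_A0menu_L2_U8_n7o8_tpm1o4_g1o14_pairAmpMax_priced_j256528`** (A0; anchor slot 0.8906812, kinematic box slot 1260041/1250000): for every `t' ∈ [−0.30, −0.20]` (U = 8), every translation-invariant density-7/8 minimiser of the `d`-wave-sourced energy at field `h = (√2 * (1/14 : ℝ))` has **`Re ω(P₀^d) ≤ 0.9887068`** (slot `2471767/2500000` = ⌈(M̃ + κ·0.1354213…)/1.41421356⌉₇). Premises BY NAME: the priced node (CANDIDATE), #445, and the A8m25 ground-state `K₂` window `hτ3` (eng rdm-tet class, the hypothesis of box-eng-2's cuprate box words). Ceiling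 only; no phase sentence. -/
theorem pin2_A0menu_L2_U8_n7o8_tpm1o4_g1o14_j256528_pairAmp_le_on_tPrimeBox_of_pricedNode_diagHopWindow
    (hP : cert_pin2_A0menu_L2_U8_n7o8_tpm1o4_g1o14_pairAmpMax_priced_j256528) (h445 : cert_dbt329pair_allk)
    (hτ3 : ∀ (ω : InfVolFermionState 2) (Ls : ℕ → ℕ) (ψ : ∀ L, Fock (Orb (FermionTorus 2 L))),
      Filter.Tendsto Ls Filter.atTop Filter.atTop →
      (∀ j, IsGroundStateInSector (hubbardTorusTT' (Ls j) 1 (-1/4) 8) (rectN (7/8) (Ls j)) 0 (ψ (Ls j))) →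
      (∀ j, star (ψ (Ls j)) ⬝ᵥ ψ (Ls j) = 1) → ω.IsTorusLimitOf ψ Ls →
      ((-6023622597/10000000000 : ℚ) : ℝ) ≤ ω.meanEnergy (hubbardTTPrimeFermionInteraction 0 1 0) 1 ∧
        ω.meanEnergy (hubbardTTPrimeFermionInteraction 0 1 0) 1 ≤ ((2174454277/2000000000 : ℚ) : ℝ))
    {t' : ℝ} (ht : t' ∈ Set.Icc (-3/10 : ℝ) (-1/5))
    {ω : InfVolFermionState 2} (hω : ω.IsTranslationInvariant) (hρ : ω.density = 7 / 8)
    (hmin : ∀ ω' : InfVolFermionState 2, ω'.IsTranslationInvariant → ω'.density = 7 / 8 →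
      ω.meanEnergy (hubbardTTPrimeSourcedInteraction 1 t' 8 0 dWaveFormFactor (Real.sqrt 2 * (1/14 : ℝ))) 1 ≤
        ω'.meanEnergy (hubbardTTPrimeSourcedInteraction 1 t' 8 0 dWaveFormFactor (Real.sqrt 2 * (1/14 : ℝ))) 1) :
    (ω.expect (pairRegion (insert 0 unitSteps) 0) (localPairAt (insert 0 unitSteps) dWaveFormFactor 0)).re ≤
      (((2471767/2500000 : ℚ)) : ℝ) := by
  have hr : |((-1/4) : ℝ) - t'| ≤ 1 / 20 := by
    rw [abs_le]; constructor <;> linarith [ht.1, ht.2]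
  have hw : (0 : ℝ) ≤ max (((2174454277/2000000000 : ℚ) : ℝ)) (-(((-6023622597/10000000000 : ℚ) : ℝ))) :=
    le_max_of_le_left (by norm_num)
  exact pairAmp_le_slot_on_tPrimeBox_of_pricedNode_of_diagHopWindow (t'₀ := -1/4) (by norm_num) (by norm_num) (by norm_num)
    (by norm_num) (by norm_num) hw hP (energyDensityTT'_le_hi445_of_node h445) hτ3
    (by rw [max_eq_left (by norm_num)]; norm_num) hr hω hρ hmin

/-- **`t'`-BOX CEILING, `K₂`-word edition, node `cert_pin2_A0menu_L2_U8_n7o8_tpm1o4_g1o7_pairAmpMax_priced_j256528`** (A0; anchor slot 1.0167138, kinematic box slot 2222713/2000000): for every `t' ∈ [−0.30, −0.20]` (U = 8), every translation-invariant density-7/8 minimiser of the `d`-wave-sourced energy at field `h = (√2 * (1/7 : ℝ))` has **`Re ω(P₀^d) ≤ 1.0957704`** (slot `1369713/1250000` = ⌈(M̃ + κ·0.1354213…)/1.41421356⌉₇). Premises BY NAME: the priced node (CANDIDATE), #445, and the A8m25 ground-state `K₂` window `hτ3` (eng rdm-tet class, the hypothesis of box-eng-2's cuprate box words). Ceiling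 only; no phase sentence. -/
theorem pin2_A0menu_L2_U8_n7o8_tpm1o4_g1o7_j256528_pairAmp_le_on_tPrimeBox_of_pricedNode_diagHopWindow
    (hP : cert_pin2_A0menu_L2_U8_n7o8_tpm1o4_g1o7_pairAmpMax_priced_j256528) (h445 : cert_dbt329pair_allk)
    (hτ3 : ∀ (ω : InfVolFermionState 2) (Ls : ℕ → ℕ) (ψ : ∀ L, Fock (Orb (FermionTorus 2 L))),
      Filter.Tendsto Ls Filter.atTop Filter.atTop →
      (∀ j, IsGroundStateInSector (hubbardTorusTT' (Ls j) 1 (-1/4) 8) (rectN (7/8) (Ls j)) 0 (ψ (Ls j))) →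
      (∀ j, star (ψ (Ls j)) ⬝ᵥ ψ (Ls j) = 1) → ω.IsTorusLimitOf ψ Ls →
      ((-6023622597/10000000000 : ℚ) : ℝ) ≤ ω.meanEnergy (hubbardTTPrimeFermionInteraction 0 1 0) 1 ∧
        ω.meanEnergy (hubbardTTPrimeFermionInteraction 0 1 0) 1 ≤ ((2174454277/2000000000 : ℚ) : ℝ))
    {t' : ℝ} (ht : t' ∈ Set.Icc (-3/10 : ℝ) (-1/5))
    {ω : InfVolFermionState 2} (hω : ω.IsTranslationInvariant) (hρ : ω.density = 7 / 8)
    (hmin : ∀ ω' : InfVolFermionState 2, ω'.IsTranslationInvariant → ω'.density = 7 / 8 →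
      ω.meanEnergy (hubbardTTPrimeSourcedInteraction 1 t' 8 0 dWaveFormFactor (Real.sqrt 2 * (1/7 : ℝ))) 1 ≤
        ω'.meanEnergy (hubbardTTPrimeSourcedInteraction 1 t' 8 0 dWaveFormFactor (Real.sqrt 2 * (1/7 : ℝ))) 1) :
    (ω.expect (pairRegion (insert 0 unitSteps) 0) (localPairAt (insert 0 unitSteps) dWaveFormFactor 0)).re ≤
      (((1369713/1250000 : ℚ)) : ℝ) := by
  have hr : |((-1/4) : ℝ) - t'| ≤ 1 / 20 := by
    rw [abs_le]; constructor <;> linarith [ht.1, ht.2]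
  have hw : (0 : ℝ) ≤ max (((2174454277/2000000000 : ℚ) : ℝ)) (-(((-6023622597/10000000000 : ℚ) : ℝ))) :=
    le_max_of_le_left (by norm_num)
  exact pairAmp_le_slot_on_tPrimeBox_of_pricedNode_of_diagHopWindow (t'₀ := -1/4) (by norm_num) (by norm_num) (by norm_num)
    (by norm_num) (by norm_num) hw hP (energyDensityTT'_le_hi445_of_node h445) hτ3
    (by rw [max_eq_left (by norm_num)]; norm_num) hr hω hρ hmin

/-- **`t'`-BOX CEILING, `K₂`-word edition, node `cert_pin2_A0menu_L3_U8_n7o8_tpm1o4_g1o28_pairAmpMax_priced_j256530`** (A0; anchor slot 0.7254738, kinematic box slot 4464241/5000000): for every `t' ∈ [−0.30, −0.20]` (U = 8), every translation-invariant density-7/8 minimiser of the `d`-wave-sourced energy at field `h = (√2 * (1/28 : ℝ))` has **`Re ω(P₀^d) ≤ 0.8652843`** (slot `8652843/10000000` = ⌈(M̃ + κ·0.1354213…)/1.41421356⌉₇). Premises BY NAME: the priced node (CANDIDATE), #445, and the A8m25 ground-state `K₂` window `hτ3` (eng rdm-tet class, the hypothesis of box-eng-2's cuprate box words). Ceiling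 only; no phase sentence. -/
theorem pin2_A0menu_L3_U8_n7o8_tpm1o4_g1o28_j256530_pairAmp_le_on_tPrimeBox_of_pricedNode_diagHopWindow
    (hP : cert_pin2_A0menu_L3_U8_n7o8_tpm1o4_g1o28_pairAmpMax_priced_j256530) (h445 : cert_dbt329pair_allk)
    (hτ3 : ∀ (ω : InfVolFermionState 2) (Ls : ℕ → ℕ) (ψ : ∀ L, Fock (Orb (FermionTorus 2 L))),
      Filter.Tendsto Ls Filter.atTop Filter.atTop →
      (∀ j, IsGroundStateInSector (hubbardTorusTT' (Ls j) 1 (-1/4) 8) (rectN (7/8) (Ls j)) 0 (ψ (Ls j))) →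
      (∀ j, star (ψ (Ls j)) ⬝ᵥ ψ (Ls j) = 1) → ω.IsTorusLimitOf ψ Ls →
      ((-6023622597/10000000000 : ℚ) : ℝ) ≤ ω.meanEnergy (hubbardTTPrimeFermionInteraction 0 1 0) 1 ∧
        ω.meanEnergy (hubbardTTPrimeFermionInteraction 0 1 0) 1 ≤ ((2174454277/2000000000 : ℚ) : ℝ))
    {t' : ℝ} (ht : t' ∈ Set.Icc (-3/10 : ℝ) (-1/5))
    {ω : InfVolFermionState 2} (hω : ω.IsTranslationInvariant) (hρ : ω.density = 7 / 8)
    (hmin : ∀ ω' : InfVolFermionState 2, ω'.IsTranslationInvariant → ω'.density = 7 / 8 →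
      ω.meanEnergy (hubbardTTPrimeSourcedInteraction 1 t' 8 0 dWaveFormFactor (Real.sqrt 2 * (1/28 : ℝ))) 1 ≤
        ω'.meanEnergy (hubbardTTPrimeSourcedInteraction 1 t' 8 0 dWaveFormFactor (Real.sqrt 2 * (1/28 : ℝ))) 1) :
    (ω.expect (pairRegion (insert 0 unitSteps) 0) (localPairAt (insert 0 unitSteps) dWaveFormFactor 0)).re ≤
      (((8652843/10000000 : ℚ)) : ℝ) := by
  have hr : |((-1/4) : ℝ) - t'| ≤ 1 / 20 := by
    rw [abs_le]; constructor <;> linarith [ht.1, ht.2]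
  have hw : (0 : ℝ) ≤ max (((2174454277/2000000000 : ℚ) : ℝ)) (-(((-6023622597/10000000000 : ℚ) : ℝ))) :=
    le_max_of_le_left (by norm_num)
  exact pairAmp_le_slot_on_tPrimeBox_of_pricedNode_of_diagHopWindow (t'₀ := -1/4) (by norm_num) (by norm_num) (by norm_num)
    (by norm_num) (by norm_num) hw hP (energyDensityTT'_le_hi445_of_node h445) hτ3
    (by rw [max_eq_left (by norm_num)]; norm_num) hr hω hρ hmin

/-- **`t'`-BOX CEILING, `K₂`-word edition, node `cert_pin2_A0menu_L3_U8_n7o8_tpm1o4_g1o7_pairAmpMax_priced_j256748`** (A0; anchor slot 0.9217060, kinematic box slot 5088299/5000000): for every `t' ∈ [−0.30, −0.20]` (U = 8), every translation-invariant density-7/8 minimiser of the `d`-wave-sourced energy at field `h = (√2 * (1/7 : ℝ))` has **`Re ω(P₀^d) ≤ 1.0018577`** (slot `10018577/10000000` = ⌈(M̃ + κ·0.1354213…)/1.41421356⌉₇). Premises BY NAME: the priced node (CANDIDATE), #445, and the A8m25 ground-state `K₂` window `hτ3` (eng rdm-tet class, the hypothesis of box-eng-2's cuprate box words). Ceiling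 only; no phase sentence. -/
theorem pin2_A0menu_L3_U8_n7o8_tpm1o4_g1o7_j256748_pairAmp_le_on_tPrimeBox_of_pricedNode_diagHopWindow
    (hP : cert_pin2_A0menu_L3_U8_n7o8_tpm1o4_g1o7_pairAmpMax_priced_j256748) (h445 : cert_dbt329pair_allk)
    (hτ3 : ∀ (ω : InfVolFermionState 2) (Ls : ℕ → ℕ) (ψ : ∀ L, Fock (Orb (FermionTorus 2 L))),
      Filter.Tendsto Ls Filter.atTop Filter.atTop →
      (∀ j, IsGroundStateInSector (hubbardTorusTT' (Ls j) 1 (-1/4) 8) (rectN (7/8) (Ls j)) 0 (ψ (Ls j))) →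
      (∀ j, star (ψ (Ls j)) ⬝ᵥ ψ (Ls j) = 1) → ω.IsTorusLimitOf ψ Ls →
      ((-6023622597/10000000000 : ℚ) : ℝ) ≤ ω.meanEnergy (hubbardTTPrimeFermionInteraction 0 1 0) 1 ∧
        ω.meanEnergy (hubbardTTPrimeFermionInteraction 0 1 0) 1 ≤ ((2174454277/2000000000 : ℚ) : ℝ))
    {t' : ℝ} (ht : t' ∈ Set.Icc (-3/10 : ℝ) (-1/5))
    {ω : InfVolFermionState 2} (hω : ω.IsTranslationInvariant) (hρ : ω.density = 7 / 8)
    (hmin : ∀ ω' : InfVolFermionState 2, ω'.IsTranslationInvariant → ω'.density = 7 / 8 →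
      ω.meanEnergy (hubbardTTPrimeSourcedInteraction 1 t' 8 0 dWaveFormFactor (Real.sqrt 2 * (1/7 : ℝ))) 1 ≤
        ω'.meanEnergy (hubbardTTPrimeSourcedInteraction 1 t' 8 0 dWaveFormFactor (Real.sqrt 2 * (1/7 : ℝ))) 1) :
    (ω.expect (pairRegion (insert 0 unitSteps) 0) (localPairAt (insert 0 unitSteps) dWaveFormFactor 0)).re ≤
      (((10018577/10000000 : ℚ)) : ℝ) := by
  have hr : |((-1/4) : ℝ) - t'| ≤ 1 / 20 := by
    rw [abs_le]; constructor <;> linarith [ht.1, ht.2]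
  have hw : (0 : ℝ) ≤ max (((2174454277/2000000000 : ℚ) : ℝ)) (-(((-6023622597/10000000000 : ℚ) : ℝ))) :=
    le_max_of_le_left (by norm_num)
  exact pairAmp_le_slot_on_tPrimeBox_of_pricedNode_of_diagHopWindow (t'₀ := -1/4) (by norm_num) (by norm_num) (by norm_num)
    (by norm_num) (by norm_num) hw hP (energyDensityTT'_le_hi445_of_node h445) hτ3
    (by rw [max_eq_left (by norm_num)]; norm_num) hr hω hρ hmin

/-- **`t'`-BOX CEILING, `K₂`-word edition, node `cert_pin2_A0menu_L1_U8_n7o8_tpm1o4_g2o7_pairAmpMax_priced_j256748`** (A0; anchor slot 1.2340761, kinematic box slot 6344109/5000000): for every `t' ∈ [−0.30, −0.20]` (U = 8), every translation-invariant density-7/8 minimiser of the `d`-wave-sourced energy at field `h = (√2 * (2/7 : ℝ))` has **`Re ω(P₀^d) ≤ 1.2630997`** (slot `12630997/10000000` = ⌈(M̃ + κ·0.1354213…)/1.41421356⌉₇). Premises BY NAME: the priced node (CANDIDATE), #445, and the A8m25 ground-state `K₂` window `hτ3` (eng rdm-tet class, the hypothesis of box-eng-2's cuprate box words). Ceiling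 only; no phase sentence. -/
theorem pin2_A0menu_L1_U8_n7o8_tpm1o4_g2o7_j256748_pairAmp_le_on_tPrimeBox_of_pricedNode_diagHopWindow
    (hP : cert_pin2_A0menu_L1_U8_n7o8_tpm1o4_g2o7_pairAmpMax_priced_j256748) (h445 : cert_dbt329pair_allk)
    (hτ3 : ∀ (ω : InfVolFermionState 2) (Ls : ℕ → ℕ) (ψ : ∀ L, Fock (Orb (FermionTorus 2 L))),
      Filter.Tendsto Ls Filter.atTop Filter.atTop →
      (∀ j, IsGroundStateInSector (hubbardTorusTT' (Ls j) 1 (-1/4) 8) (rectN (7/8) (Ls j)) 0 (ψ (Ls j))) →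
      (∀ j, star (ψ (Ls j)) ⬝ᵥ ψ (Ls j) = 1) → ω.IsTorusLimitOf ψ Ls →
      ((-6023622597/10000000000 : ℚ) : ℝ) ≤ ω.meanEnergy (hubbardTTPrimeFermionInteraction 0 1 0) 1 ∧
        ω.meanEnergy (hubbardTTPrimeFermionInteraction 0 1 0) 1 ≤ ((2174454277/2000000000 : ℚ) : ℝ))
    {t' : ℝ} (ht : t' ∈ Set.Icc (-3/10 : ℝ) (-1/5))
    {ω : InfVolFermionState 2} (hω : ω.IsTranslationInvariant) (hρ : ω.density = 7 / 8)
    (hmin : ∀ ω' : InfVolFermionState 2, ω'.IsTranslationInvariant → ω'.density = 7 / 8 →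
      ω.meanEnergy (hubbardTTPrimeSourcedInteraction 1 t' 8 0 dWaveFormFactor (Real.sqrt 2 * (2/7 : ℝ))) 1 ≤
        ω'.meanEnergy (hubbardTTPrimeSourcedInteraction 1 t' 8 0 dWaveFormFactor (Real.sqrt 2 * (2/7 : ℝ))) 1) :
    (ω.expect (pairRegion (insert 0 unitSteps) 0) (localPairAt (insert 0 unitSteps) dWaveFormFactor 0)).re ≤
      (((12630997/10000000 : ℚ)) : ℝ) := by
  have hr : |((-1/4) : ℝ) - t'| ≤ 1 / 20 := by
    rw [abs_le]; constructor <;> linarith [ht.1, ht.2]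
  have hw : (0 : ℝ) ≤ max (((2174454277/2000000000 : ℚ) : ℝ)) (-(((-6023622597/10000000000 : ℚ) : ℝ))) :=
    le_max_of_le_left (by norm_num)
  exact pairAmp_le_slot_on_tPrimeBox_of_pricedNode_of_diagHopWindow (t'₀ := -1/4) (by norm_num) (by norm_num) (by norm_num)
    (by norm_num) (by norm_num) hw hP (energyDensityTT'_le_hi445_of_node h445) hτ3
    (by rw [max_eq_left (by norm_num)]; norm_num) hr hω hρ hmin

end Summit.Ventures.CertifiedManyBodySolver.Certificates

end
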